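import Summits.NavierStokesRegularity.NavierStokesRegularity.Theorems.GaldiLiouvilleGateRecordZoomAncientOscillationBump
import HarnessLib

/-!
# Route `GaldiLiouvilleGate`, crux `RecordZoomAncient` (stmt-NavierStokesRegularity-0894),
  line `registered` — `Z` from the CLEAN KERNEL "every blow-up carries a persistent critical oscillation bump"

Lead `prover-line-stmt-NavierStokesRegularity-0894-c5-0`, 2026-08-17. One theorem (namespace
`…Theorems.RecordZoomAncient.Birth`):

* `recordZoomAncient_of_blowupCarriesBump` — the crux `RecordZoomAncient` from the clean, fileable form of the line's
  residual kernel: **(K) every classical solution on `ℝ³ × [0,T)` which is Leray–Hopf from a rapidly decaying datum and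
  has no smooth extension past `T` carries a persistent critical oscillation bump** — base times `tc n ∈ (0,T)`, point
  pairs `x₁ n, x₂ n` with `‖x₁ n − x₂ n‖ ≤ R₀ν/M n`, velocity levels `M n > 0` dominating `‖u‖` on `[0, tc n] × ℝ³` with
  `tc n (M n)² → ∞`, an oscillation `‖u(tc n, x₁ n) − u(tc n, x₂ n)‖ ≥ θ M n`, and one constant `D` bounding, for every
  `R, S > 0` eventually in `n`, the local enstrophy `∫_{B(x₁ n, Rν/M n)} |∇u(t)|² ≤ DνM n` for
  `t ∈ [tc n − Sν/(M n)², tc n] ∩ [0, tc n]`. The proof is one line over the r8 rung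
  `recordZoomAncientAt_of_oscillationBump` (p166059). (K) implies the registered stub `stub_oscillationKernel` of
  `Cruxes/RecordZoomAncient/Lines/birth.lean` (which has the extra hypotheses (1)–(4) of r5–r7 available) trivially, and
  is the statement the dossier `Cruxes/RecordZoomAncient/KERNEL.md` recommends filing as the conjecture-class item if the
  stub is promoted: its hypothesis block is exactly that of `RecordZoomAncient`, its conclusion is about `u` alone.

Source of the mechanism: G. Koch, N. Nadirashvili, G. Seregin, V. Šverák, Acta Math. 203 (2009), §6 (velocity zooms).
-/

noncomputable section

open Set MeasureTheory Filter Topology Function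
open scoped ENNReal NNReal
open Literature.Analysis.FluidPDE

namespace Summit.NavierStokesRegularity.NavierStokesRegularity.Theorems.RecordZoomAncient.Birth

-- the problem-side namespace `Summit.NavierStokesRegularity.NavierStokesRegularity.…` (summit =
-- problem for this single-problem summit) duplicates `NavierStokesRegularity` by design
set_option linter.dupNamespace false

/-- **`Z` from the clean kernel (K) "every blow-up carries a persistent critical oscillation bump".** The hypothesis is
(K) verbatim: for `ν, T > 0` and a classical solution `(u, p)` on `ℝ³ × [0,T)`, Leray–Hopf from the rapidly decaying
`u 0`, with no smooth extension past `T`, there are base times `tc n ∈ (0,T)`, point pairs `x₁ n, x₂ n`, levels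
`M n > 0` with `‖u‖ ≤ M n` on `[0, tc n] × ℝ³` and `tc n (M n)² → ∞`, constants `θ, R₀ > 0` and `D` with
`‖x₁ n − x₂ n‖ ≤ R₀ν/M n`, `‖u(tc n, x₁ n) − u(tc n, x₂ n)‖ ≥ θ M n`, and, for all `R, S > 0` eventually in `n`,
`∫_{B(x₁ n, Rν/M n)} |∇u(t)|² ≤ DνM n` for `t ∈ [0, tc n]`, `t ≥ tc n − Sν/(M n)²`. Conclusion: the crux
`RecordZoomAncient` by name. Proof: feed the bump to the r8 rung `recordZoomAncientAt_of_oscillationBump`. -/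
theorem recordZoomAncient_of_blowupCarriesBump :
    (∀ (ν T : ℝ), 0 < ν → 0 < T → ∀ (u : ℝ → EuclideanSpace ℝ (Fin 3) → EuclideanSpace ℝ (Fin 3)) (p : ℝ →
      EuclideanSpace ℝ (Fin 3) → ℝ), IsClassicalNSSolutionOn (Set.Ico 0 T) ν 0 u p → IsLerayHopfOn T ν 0 (u 0)
      u → HasRapidSpatialDecay (u 0) → ¬ HasSmoothExtensionPast ν 0 u T →
      ∃ (tc : ℕ → ℝ) (x₁ x₂ : ℕ → EuclideanSpace ℝ (Fin 3)) (M : ℕ → ℝ) (θ R₀ D : ℝ),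
        (∀ n, 0 < tc n ∧ tc n < T) ∧ (∀ n, 0 < M n) ∧
        (∀ n, ∀ t ∈ Set.Icc 0 (tc n), ∀ x, ‖u t x‖ ≤ M n) ∧
        Filter.Tendsto (fun n => tc n * M n ^ 2) Filter.atTop Filter.atTop ∧
        0 < θ ∧ 0 < R₀ ∧ (∀ n, ‖x₁ n - x₂ n‖ ≤ R₀ * (ν / M n)) ∧
        (∀ n, θ * M n ≤ ‖u (tc n) (x₁ n) - u (tc n) (x₂ n)‖) ∧
        (∀ R S : ℝ, 0 < R → 0 < S → ∀ᶠ n in Filter.atTop, ∀ t ∈ Set.Icc 0 (tc n),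
          tc n - S * (ν / M n ^ 2) ≤ t →
          (∫⁻ y in Metric.ball (x₁ n) (R * (ν / M n)), ENNReal.ofReal (frobeniusNormSq (fderiv ℝ (u t) y))) ≤
            ENNReal.ofReal (D * (ν * M n)))) →
      Summit.NavierStokesRegularity.NavierStokesRegularity.Theses.GaldiLiouvilleGate.RecordZoomAncient := by
  intro hK ν T hν hT u p hcl hLH hdec hnext
  obtain ⟨tc, x₁, x₂, M, θ, R₀, D, htc, hM, hdomV, hpast, hθ, hR₀, hdist, hosc, hE⟩ :=
    hK ν T hν hT u p hcl hLH hdec hnext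
  exact recordZoomAncientAt_of_oscillationBump ν T hν hT u p hcl hLH tc x₁ x₂ M θ R₀ D htc hM hdomV hpast hθ hR₀
    hdist hosc hE

end Summit.NavierStokesRegularity.NavierStokesRegularity.Theorems.RecordZoomAncient.Birth

end
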